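import Summits.Ventures.QEC.CircuitDistance.ETowerTop
import Summits.Ventures.QEC.CircuitDistance.ETowerLeverJSound
import HarnessLib

/-!
# E-fold tower: the guarded short-cut node OVER THE SLIM NODE `nodeJ`, and its soundness (cell `qec`, experiment CDX,
# seat qec-cdx-type-2 g0; the «nodeJ short-cut lemma» of qec-cdx-crit-1 g2's closing list, needed by the #345 `W = 10`
# tower whose landed K-file `ETowerK345X` has `nodeC S := (S.length ≤ 4 && (matchRep …).isSome) || nodeJ GC 180 … ktop S`)

`nodeGdJ` = the landed `nodeGdG` (ETowerTop, type-1) with `nodeJ` (ETowerLeverJ, idea-1 g4) for `nodeK`; **`nodeGdJ_sound`** = the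
landed `nodeGdG_sound` with `nodeJ_sound` (ETowerLeverJSound) for `nodeK_sound` — same hypotheses, same conclusion `GoodFibK … (maskOf S)`.
A sector file whose `nodeC` is literally this shape instantiates it by `rfl`/`change`, exactly as `ETowerNodesX.hkCX` does for `nodeGdG`.
Generic; no data; std axioms; no `native_decide`. Nothing here changes a deployed code.
-/

namespace Summit.Ventures.QEC.CircuitDistance.ETower

open Summit.Ventures.QEC.Census Summit.Ventures.QEC.Census.Fold

/-- The node shape with a short-cut under an arbitrary Bool guard `g`, continuing with the SLIM node `nodeJ`
(the #345 K-file uses `g S = decide (S.length ≤ 4)`). -/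
noncomputable def nodeGdJ (G : Geo) (ns : ℕ) (M Mp : ℕ → ℕ) (W : ℕ) (k : List ℕ → Bool) (g : List ℕ → Bool) (md : ℕ)
    (SPEC : List ℕ) (S : List ℕ) : Bool :=
  (g S && (matchRep G.ls G.ms md (repStore md SPEC) false S).isSome) || nodeJ G ns M Mp W k S

/-- **Soundness of the guarded short-cut node over `nodeJ`** (any guard): a passing node gives `GoodFibK` of the word, the
short-cut classes `SPEC` being certified separately (as `nodeGdG_sound`, with `nodeJ_sound` for `nodeK_sound`). -/
theorem nodeGdJ_sound {G : Geo} {nb : ℕ} (hS : G.Shape) (hG : OKK G nb) {col : ℕ → ℕ}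
    (hK : ∀ da db u, u < 2 ^ nK G nb → (kerK col (nK G nb) u ↔ kerK col (nK G nb) (transWK G.l G.m nb da db u)))
    {M Mp : ℕ → ℕ} (hM : ∀ j, j < nsK G nb → M j = col (G.emb j) ^^^ col (G.partner (G.emb j)))
    (hMp : ∀ j, j < nsK G nb → Mp j = col (G.partner (G.emb j)))
    {W : ℕ} {k : List ℕ → Bool} {Q : ℕ → Prop} (hQ : ∀ da db u, Q (transWK G.l G.m nb da db u) → Q u)
    (hk : ∀ S', (∀ J ∈ S', J < nK G nb) → S'.length = popc (nK G nb) (maskOf S') → k S' = true → Q (maskOf S'))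
    {g : List ℕ → Bool} {md : ℕ} {SPEC : List ℕ} (hSPEC : ∀ r ∈ SPEC, GoodFibK G nb col W Q r)
    {S : List ℕ} (hSb : ∀ j ∈ S, j < nsK G nb) (h : nodeGdJ G (nsK G nb) M Mp W k g md SPEC S = true) :
    GoodFibK G nb col W Q (maskOf S) := by
  unfold nodeGdJ at h
  rw [Bool.or_eq_true] at h
  rcases h with h | h
  · rw [Bool.and_eq_true] at h
    rcases matchedK_of_matchRep (nb := nb) hSb h.2 with ⟨-, hf⟩ | hM
    · exact absurd hf Bool.false_ne_true
    · exact goodFibK_of_matched hS hG hK hQ hSPEC hM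
  · exact nodeJ_sound hS hG (hK G.gen.1 G.gen.2) hM hMp (hQ G.gen.1 G.gen.2) hk hSb h

end Summit.Ventures.QEC.CircuitDistance.ETower
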